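import Mathlib
import Summits.Langlands.Langlands.Theses.NonParallelVoid
import Literature.NumberTheory.GaloisRepresentations.PstCrystallineExtensionData
import Literature.NumberTheory.GaloisRepresentations.EnormousSubgroup
import Literature.NumberTheory.GaloisRepresentations.ProjectiveType
import Literature.NumberTheory.GaloisRepresentations.DecomposedGeneric
import Literature.NumberTheory.GaloisRepresentations.AbsGaloisGroup
import Literature.NumberTheory.Automorphic.Qian2022PotentialAutomorphy
import Literature.NumberTheory.Automorphic.BLGGT2014PotentialAutomorphy
import Literature.NumberTheory.Automorphic.CaraianiLeHungComplexConjugation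
import Literature.NumberTheory.Automorphic.AHTW2026HodgeTateWeights
import Literature.NumberTheory.PAdicHodge.LabelledHodgeTateWeightsBaseChangeLabelwise
import Literature.NumberTheory.GaloisRepresentations.AbsGaloisOuterConj
import Literature.NumberTheory.GaloisRepresentations.ToLocalRestrictField
import Summits.Langlands.Langlands.Theorems.NonParallelVoidTensorSquareParallelStubDihedralTypeOfTrace
import Summits.Langlands.Langlands.Theorems.NonParallelVoidTensorSquareParallelStubEnormousResidualPackage
import Summits.Langlands.Langlands.Theorems.NonParallelVoidTensorSquareParallelStubResidualIrreducibility
import Summits.Langlands.Langlands.Theorems.NonParallelVoidTensorSquareParallelStubTensorInductionExists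
import Summits.Langlands.Langlands.Theorems.NonParallelVoidTensorSquareParallelStubTraceComplexConjugation
import Summits.Langlands.Langlands.Theorems.NonParallelVoidTensorSquareParallelStubOrdinaryDihedralVoid
import HarnessLib

/-!
# Line `merged` — crux `TensorSquareParallel` (item stmt-Langlands-17009) of route `NonParallelVoid`

Crux-strategist seat `planner-cstrat-stmt-Langlands-17009-b1-0`, 2026-08-17.  THE RECOMMENDED ACTIVE SKELETON:
the birth line (tensor induction, `Lines/birth.lean`) and the strategist's transfer line (`Lines/qian_transfer.lean`)
are COMPLEMENTARY — birth owns the crux off the projectively-dihedral locus, qian_transfer owns the nearly-ordinary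
half of that locus — so this file merges them into ONE seven-stub skeleton in which every stub is first-class and
the open remainder is minimal (`stub_supersingularDihedral`).  Merges forced by the seven-stub cap, both natural:
birth stubs 1+2 (the local potential-diagonalisability input is folded into the tensor-induction stub, whose (T3)
asserts PD of `ψ` at `p`), qian_transfer stubs 3+4 (enormousness folded into the residual package) and 5+6 (Qian's
potential automorphy and the purity contradiction, both citation-grade, folded into "the nearly ordinary corner
is void").

The crux: `F` imaginary quadratic, `p ≥ 11` split, `ρ : Γ_F → GL₂(ℚ̄_p)` irreducible, a.e. unramified,
crystalline above `p` with labelled Hodge–Tate weights `{a_v < b_v}`, `ρ̄|Γ_{F(ζ_p)}` absolutely irreducible, odd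
gap sum, `ρ̄` NOT of base-change type ⟹ parallel gaps (void).  OFF the dihedral locus: `ψ = ⊗-Ind ρ` is regular
(gaps differ), `GO₄` with totally even multiplier, PD; Clifford ⟹ `ψ̄|Γ_{ℚ(ζ_p)}` irreducible; [BLGGT] Thm. C +
Caraiani–Le Hung ⟹ `tr ψ(c) = 0` vs `2`.  ON it, nearly ordinary: dihedral images of order prime to `p` are
ENORMOUS, decomposed generic is Caraiani–Newton 6.2.2, the scalar element is ACC+ Rem. 6.1.4, so Qian 2023
Thm. 1.4 makes `ρ|Γ_{K'}` automorphic over a CM `K'`, and Clozel purity forces equal gaps.  ON it, supersingular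
somewhere: open (torsion-fed emptiness / overconvergent classicality; STRATEGY-CENSUS.md).

`TensorSquareParallel_of (h₁ … h₇)` is KERNEL-CHECKED (no sorry outside `stub_*`).

RESHAPE v2 (lead prover-line-stmt-Langlands-17009-0, 2026-08-17, after wave 1; wave 2 landed stub_tensorInductionExists p169281,
stub_traceComplexConjugation p169312, stub_ordinaryDihedralVoid p169582 (+ helper stub_labelExtension p169377) — 3 sorries remain:
stub_tensorInductionLocal (pinned-datum clause gap), stub_externalInputs (named facts), stub_supersingularDihedral (open sector S)): stubs `stub_residualIrreducibility`
(p168846), `stub_dihedralType_of_trace` (p167854), `stub_enormousResidualPackage` (p168313) are LANDED under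
`Summits/Langlands/Langlands/Theorems/NonParallelVoidTensorSquareParallelStub*.lean` and are now theorems of this file
(imported, no sorry); `stub_tensorInductionPD` is cut into the provable global part `stub_tensorInductionExists` (its
(T0),(T1),(T2),(T5) landed as `stub_tensorInductionPD_exists`, p167980; (T0') added) and the local clause
`stub_tensorInductionLocal` (pinned-datum ⊗-functoriality gap); the citation-grade stubs `stub_traceComplexConjugation`
and `stub_ordinaryDihedralVoid` become provable COMPOSITIONS whose external inputs are antecedents, collected by
name in `stub_externalInputs` (named facts: BLGGT Thm C p167014, CLH, Qian, AHTW p166838, HT base change p167048 +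
the near-ordinary ⇒ Qian-ordinary local lemma); `stub_ordinaryDihedralVoid` gains the SPLIT hypothesis (wave-1 verdict
stub-misstated); `stub_supersingularDihedral` (sector S) unchanged.  Six stubs.

RESHAPE v3 (lead c1 prover-line-stmt-Langlands-17009-c1-0, 2026-08-17): stub 7 is cut into stub 7a `stub_unramifiedOutsidePVoid`
(the locus "`ρ` unramified at every finite place prime to `p`" is void OUTRIGHT in all sectors: odd gap sum ⟹ odd weight
sum of `det ρ` at the two split places ⟹ contradiction with global reciprocity at the unit `-1`; provable, size M) and
stub 7b `stub_supersingularDihedralRamified` (v2 stub 7 plus the hypothesis "ramified at some `𝔮 ∤ p`"; the honest open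
remainder).  `TensorSquareParallel_of` now opens with `by_cases` on that locus.  Seven stubs total (4 open: 2, 3, 7a, 7b).

Disproof used (Cruxes/TensorSquareParallel/Disproof.lean @ cdisprove cycle 1, read 2026-08-17T18:20Z): §2 "¬BaseChangeType is
decoration" = the determinant-parity computation behind stub 7a (here turned into a POSITIVE sub-case instead of a redundancy
remark); §4 caveat on stub 2 (pinned crystallinity of `ψ` needs a ⊗-closure clause the datum lacks) = why stub 2 is being
re-typed with named schemata as antecedents (wave 3); no `_false_without_` theorem is certified, no stub refuted; negatives (4)
unrelated; dead lines: none.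

References: as in `Lines/birth.md` and `Lines/qian-transfer.md` — [Calegari2010] §2, Thm. 1.4; [BarnetlambEtAl2014]
Thm. C, §1.4, §2.1; [CaraianiLehung2016] Thm. 1.1; [Qian2022] Thm. 1.4; [ACCGHLNSTT2023] Thm. 6.1.2, Rem. 6.1.3–4,
Def. 6.2.28; [CaraianiNewton2023] Lemma 6.2.2; [Clozel1990] Lemme 4.9; AHTW arXiv:2607.11763 Thm. 1.2.1;
[CalegariMazur2008] Conj. 1.3.
-/

noncomputable section

set_option linter.dupNamespace false

open scoped NumberField Kronecker
open IsDedekindDomain Field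
open Literature.NumberTheory.GaloisRepresentations Literature.NumberTheory.PAdicHodge
  Literature.NumberTheory.Automorphic

namespace Summit.Langlands.Langlands.Cruxes.TensorSquareParallel.Merged

/-- **stub 1 — Calegari's tensor induction `ψ = ⊗-Ind_{Γ_F}^{Γ_ℚ} ρ` exists, with its GLOBAL properties** (reshaped 2026-08-17 by the lead from `stub_tensorInductionPD`, whose (T0),(T1),(T2),(T5) are LANDED as `Theorems.TensorSquareParallel.stub_tensorInductionPD_exists`, p167980): (T0) `tr ψ(res σ) = tr ρ(σ)·tr ρ(τστ⁻¹)`; (T0') NEW — the restriction to `Γ_F` IS the Kronecker product `ρ ⊗ ρ^{θ_{τ₀}}` up to a fixed frame change `P` and relabelling `e` (this pins `ψ|Γ_F` itself, not only its character, so that the local clause (T3) is a statement about `ρ.toLocal v ⊗ ρ.toLocal w`); (T1) a.e. unramified; (T2) `GO₄` with totally even multiplier; (T5) `tr ψ(c) ≠ 0`.  Provable now from the landed construction `tensorInduce` (`tensorInduce_apply_coe`, `tiMatrixHom_absGaloisRestrict`).  [cite: Calegari2010, §2 (Lemma 2.1)] -/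
theorem stub_tensorInductionExists :
    ∀ (F : Type) [Field F] [NumberField F] [Algebra.IsQuadraticExtension ℚ F], NumberField.IsTotallyComplex F → ∀ (p : ℕ) [Fact p.Prime] (ρ : FramedGaloisRep F (PadicAlgCl p) 2), (∀ᶠ v : HeightOneSpectrum (𝓞 F) in Filter.cofinite, ρ.IsUnramifiedAt v) → ∃ ψ : FramedGaloisRep ℚ (PadicAlgCl p) 4, (∀ τ : absoluteGaloisGroup ℚ, τ ∉ Set.range (absGaloisRestrict ℚ F) → ∀ σ σ' : absoluteGaloisGroup F, absGaloisRestrict ℚ F σ' = τ * absGaloisRestrict ℚ F σ * τ⁻¹ → (ψ (absGaloisRestrict ℚ F σ)).val.trace = (ρ σ).val.trace * (ρ σ').val.trace) ∧ (∃ (τ₀ : absoluteGaloisGroup ℚ) (_ : τ₀ ∉ Set.range (absGaloisRestrict ℚ F)) (e : Fin 2 × Fin 2 ≃ Fin 4) (P : GL (Fin 4) (PadicAlgCl p)), ∀ σ : absoluteGaloisGroup F, (ψ (absGaloisRestrict ℚ F σ)).val = P.val * Matrix.reindex e e ((ρ σ).val ⊗ₖ (ρ (absGaloisOuterConj ℚ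 F τ₀ σ)).val) * P⁻¹.val) ∧ (∀ᶠ v : HeightOneSpectrum (𝓞 ℚ) in Filter.cofinite, ψ.IsUnramifiedAt v) ∧ (∃ (J : Matrix (Fin 4) (Fin 4) (PadicAlgCl p)) (μ : absoluteGaloisGroup ℚ →* (PadicAlgCl p)ˣ), J.IsSymm ∧ IsUnit J.det ∧ (∀ g : absoluteGaloisGroup ℚ, (ψ g).val.transpose * J * (ψ g).val = (μ g : PadicAlgCl p) • J) ∧ ∀ (φ : ℚ →+* ℝ) (c : absoluteGaloisGroup ℚ), IsComplexConjugation φ c → μ c = 1) ∧ (∀ (φ : ℚ →+* ℝ) (c : absoluteGaloisGroup ℚ), IsComplexConjugation φ c → (ψ c).val.trace ≠ 0) :=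
  Summit.Langlands.Langlands.Theorems.TensorSquareParallel.stub_tensorInductionExists  -- LANDED p169281

/-- **stub 2 — the LOCAL clause of the tensor induction (the pinned-datum ⊗-functoriality gap; reshaped out of `stub_tensorInductionPD`).**  For `ρ` crystalline at the two places `v ≠ w` over the split `p` with labelled weights `{a<b}`, `{a'<b'}`, `b−a ≠ b'−a'`, EVERY `ψ` over `ℚ` whose restriction to `Γ_F` is a conjugate of `ρ ⊗ ρ^θ` (T0') is, at the place of `ℚ` over `p` and for THE pinned datum: crystalline, with four distinct labelled Hodge–Tate numbers, with inhabited crystalline extension data, and potentially diagonalisable for every such datum.  STATUS (wave 1, worker diagnosis): NOT derivable in-tree — the pinned datum `fontainePstAdicCompletion` is specified by clauses (F1)–(F12) of `IsFontaineDatum`, none of which relates `IsCrystallineFramed` / `labelledHodgeTateWeightsAt` / `IsPotentiallyDiagonalizable` of a Kronecker product (or of a restriction along `F_w ≅ ℚ_p`) to those of its factors; nearest existing named facts: `CrystallineBaseChange`, `LabelledHodgeTateWeightsBaseChange`, `FontaineDatumExists` (for `Nonempty`), the ⊗-TODO of `blggt2014_connects_blockSum`, and PD of the rank-two factors = item PD2Unram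 (stmt-Langlands-14643) / `blggt2014_lemma_1_4_3_2` (FL range only).  [cite: BarnetlambEtAl2014, §1.4] [cite: BrinonConrad2009, §9.1 (D_cris, D_dR are ⊗-functors)] -/
theorem stub_tensorInductionLocal :
    ∀ (F : Type) [Field F] [NumberField F] [Algebra.IsQuadraticExtension ℚ F], NumberField.IsTotallyComplex F → ∀ (p : ℕ) [Fact p.Prime] (ρ : FramedGaloisRep F (PadicAlgCl p) 2), (∀ (v : HeightOneSpectrum (𝓞 F)) (hv : ((p : ℕ) : 𝓞 F) ∈ v.asIdeal), (fontainePstAdicCompletion v p hv).IsDeRhamFramed (ρ.toLocal v) ∧ (letI := (fontainePstAdicCompletion v p hv).algebra; ∀ τ : v.adicCompletion F →ₐ[ℚ_[p]] PadicAlgCl p, ∃ a b : ℤ, a < b ∧ ρ.labelledHodgeTateWeightsAt v (fontainePstAdicCompletion v p hv).algebra (fontainePstAdicCompletion v p hv).𝔅 τ.toRingHom = {a, b})) → (11 ≤ p ∧ (∃ v w : HeightOneSpectrum (𝓞 F), v ≠ w ∧ ((p : ℕ) : 𝓞 F) ∈ v.asIdeal ∧ ((p : ℕ) : 𝓞 F)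 ∈ w.asIdeal) ∧ (∀ (v : HeightOneSpectrum (𝓞 F)) (hv : ((p : ℕ) : 𝓞 F) ∈ v.asIdeal), (fontainePstAdicCompletion v p hv).IsCrystallineFramed (ρ.toLocal v)) ∧ FramedGaloisRep.IsResiduallyAbsIrreducible (ρ.restrictField (CyclotomicField p F))) → (∃ (v : HeightOneSpectrum (𝓞 F)) (hv : ((p : ℕ) : 𝓞 F) ∈ v.asIdeal) (w : HeightOneSpectrum (𝓞 F)) (hw : ((p : ℕ) : 𝓞 F) ∈ w.asIdeal), letI := (fontainePstAdicCompletion v p hv).algebra; letI := (fontainePstAdicCompletion w p hw).algebra; ∃ (τ : v.adicCompletion F →ₐ[ℚ_[p]] PadicAlgCl p) (σ : w.adicCompletion F →ₐ[ℚ_[p]] PadicAlgCl p) (a b a' b' : ℤ), ρ.labelledHodgeTateWeightsAt v (fontainePstAdicCompletion v p hv).algebra (fontainePstAdicCompletion v p hv).𝔅 τ.toRingHom = {a, b} ∧ a < b ∧ ρ.labelledHodgeTateWeightsAt w (fontainePstAdicCompletion w p hw).algebra (fontainePstAdicCompletion w p hw).𝔅 σ.toRingHom = {a', b'} ∧ a'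 < b' ∧ b - a ≠ b' - a') → ∀ ψ : FramedGaloisRep ℚ (PadicAlgCl p) 4, (∃ (τ₀ : absoluteGaloisGroup ℚ) (_ : τ₀ ∉ Set.range (absGaloisRestrict ℚ F)) (e : Fin 2 × Fin 2 ≃ Fin 4) (P : GL (Fin 4) (PadicAlgCl p)), ∀ σ : absoluteGaloisGroup F, (ψ (absGaloisRestrict ℚ F σ)).val = P.val * Matrix.reindex e e ((ρ σ).val ⊗ₖ (ρ (absGaloisOuterConj ℚ F τ₀ σ)).val) * P⁻¹.val) → (∀ (v : HeightOneSpectrum (𝓞 ℚ)) (hv : ((p : ℕ) : 𝓞 ℚ) ∈ v.asIdeal), (fontainePstAdicCompletion v p hv).IsCrystallineFramed (ψ.toLocal v) ∧ (letI := (fontainePstAdicCompletion v p hv).algebra; (∀ τ : v.adicCompletion ℚ →ₐ[ℚ_[p]] PadicAlgCl p, (let M := ψ.labelledHodgeTateWeightsAt v (fontainePstAdicCompletion v p hv).algebra (fontainePstAdicCompletion v p hv).𝔅 τ.toRingHom; M.Nodup ∧ Multiset.card M = 4)) ∧ Nonempty (PstCrystallineExtensionData (fontainePstAdicCompletion v p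 hv)) ∧ ∀ 𝔈 : PstCrystallineExtensionData (fontainePstAdicCompletion v p hv), IsPotentiallyDiagonalizable 𝔈.𝔅 (ψ.toLocal v))) := by
  sorry

/-- **stub 3 — the EXTERNAL INPUTS of the line, by name (reshaped 2026-08-17):** the published theorems the two engines consume, as the tree's NAMED FACTS (each `def … : Prop`, cited, accepted; three of them vendored by this line's wave 1), and the one local lemma of the ordinary corner that the pinned datum's clauses cannot yet express (v3: headed by the T0 fact `FontaineDatumExists`, Fontaine's construction of `(B_dR, WD ∘ D_pst)`, under which alone the clauses (F1)–(F13) are predicated of THE datum — consumed by stub 7a): `FontaineDatumExists` ∧ `BLGGT2014_thmC_potentialAutomorphy` ([BLGGT] Thm C, p167014) ∧ `CaraianiLeHung2016_thm_1_1` ∧ `AHTW2026.hodgeTateWeights_eq` at the pinned data (AHTW 2026 Thm 1.2.1, p166838) ∧ `LabelledHodgeTateWeightsBaseChangeLabelwise` (Brinon–Conrad 6.3.8, p167048) ∧ ∃ local Artin data 𝓐 with `Qian2022.potentialAutomorphy_ordinary 𝓐 (pinned data)` (Qian 2023 Thm 1.4) and the LOCAL LEMMA "near-ordinary + pinned-crystalline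 + labelled weights {a<b} at a SPLIT p ⇒ Qian-ordinary with regular weights at v" (Fontaine sub-object functoriality + crystalline characters + Bloch–Kato `H¹_f(ℚ_p, ψ₁ψ₂⁻¹) = 0` for positive weight; false without the split hypothesis — worker's counterexample over quadratic `F_v`).  This stub is DISCHARGEABLE ONLY BY PROVING/UPGRADING THOSE FACTS (literature-prover debt), never by this line; it is registered so that the composition is kernel-checked modulo exactly these names.  [cite: BarnetlambEtAl2014, Thm C] [cite: CaraianiLehung2016, Thm 1.1] [cite: Qian2022, Thm. 1.4, Def. 1.2] [cite: BrinonConrad2009, Prop. 6.3.8] -/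
theorem stub_externalInputs :
    FontaineDatumExists ∧ BLGGT2014_thmC_potentialAutomorphy ∧ CaraianiLeHung2016_thm_1_1 ∧ AHTW2026.hodgeTateWeights_eq (fun (K : Type) (_ : Field K) (_ : NumberField K) (p : ℕ) (_ : Fact p.Prime) (v : HeightOneSpectrum (𝓞 K)) (hv : ((p : ℕ) : 𝓞 K) ∈ v.asIdeal) => fontainePstAdicCompletion v p hv) ∧ LabelledHodgeTateWeightsBaseChangeLabelwise ∧ ∃ 𝓐 : (∀ (K : Type) [Field K] [NumberField K] (v : HeightOneSpectrum (𝓞 K)), LocalArtinData (v.adicCompletion K)), Qian2022.potentialAutomorphy_ordinary 𝓐 (fun (K : Type) (_ : Field K) (_ : NumberField K) (p : ℕ) (_ : Fact p.Prime) (v : HeightOneSpectrum (𝓞 K)) (hv : ((p : ℕ) : 𝓞 K) ∈ v.asIdeal) => fontainePstAdicCompletion v p hv) ∧ (∀ (F : Type) [Field F] [NumberField F] [Algebra.IsQuadraticExtension ℚ F] (p : ℕ) [Fact p.Prime] (ρ : FramedGaloisRep F (PadicAlgCl p) 2), (∃ v w : HeightOneSpectrum (𝓞 F), v ≠ w ∧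 ((p : ℕ) : 𝓞 F) ∈ v.asIdeal ∧ ((p : ℕ) : 𝓞 F) ∈ w.asIdeal) → ∀ (v : HeightOneSpectrum (𝓞 F)) (hv : ((p : ℕ) : 𝓞 F) ∈ v.asIdeal), (fontainePstAdicCompletion v p hv).IsCrystallineFramed (ρ.toLocal v) → (letI := (fontainePstAdicCompletion v p hv).algebra; ∀ τ : v.adicCompletion F →ₐ[ℚ_[p]] PadicAlgCl p, ∃ a b : ℤ, a < b ∧ ρ.labelledHodgeTateWeightsAt v (fontainePstAdicCompletion v p hv).algebra (fontainePstAdicCompletion v p hv).𝔅 τ.toRingHom = {a, b}) → FramedRep.HasInvariantCompleteFlag (ρ.toLocal v) → ρ.IsOrdinaryRegularAt v (𝓐 F v)) := by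
  sorry

/-- **stub 4 — the engine off the corner, as a COMPOSITION of the named facts (reshaped 2026-08-17: [BLGGT] Thm C and Caraiani–Le Hung Thm 1.1 are now ANTECEDENTS, and (T3) carries the `Nonempty (PstCrystallineExtensionData …)` conjunct Thm C's PD clause needs):** `p ≥ 11`, `ψ : Γ_ℚ → GL₄(ℚ̄_p)` a.e. unramified, `GO₄` with totally even multiplier, crystalline with four distinct labelled HT numbers and PD at `p`, residually absolutely irreducible on `Γ_{ℚ(ζ_p)}` ⟹ `tr ψ(c) = 0` at every complex conjugation.  Provable now (wave-1 scratch `traceComplexConjugation_of_BLGGT_thmC`, kernel-checked).  [cite: BarnetlambEtAl2014, Thm. C] [cite: CaraianiLehung2016, Thm 1.1] -/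
theorem stub_traceComplexConjugation :
    BLGGT2014_thmC_potentialAutomorphy → CaraianiLeHung2016_thm_1_1 → ∀ (p : ℕ) [Fact p.Prime], 11 ≤ p → ∀ ψ : FramedGaloisRep ℚ (PadicAlgCl p) 4, (∀ᶠ v : HeightOneSpectrum (𝓞 ℚ) in Filter.cofinite, ψ.IsUnramifiedAt v) → (∃ (J : Matrix (Fin 4) (Fin 4) (PadicAlgCl p)) (μ : absoluteGaloisGroup ℚ →* (PadicAlgCl p)ˣ), J.IsSymm ∧ IsUnit J.det ∧ (∀ g : absoluteGaloisGroup ℚ, (ψ g).val.transpose * J * (ψ g).val = (μ g : PadicAlgCl p) • J) ∧ ∀ (φ : ℚ →+* ℝ) (c : absoluteGaloisGroup ℚ), IsComplexConjugation φ c → μ c = 1) → (∀ (v : HeightOneSpectrum (𝓞 ℚ)) (hv : ((p : ℕ) : 𝓞 ℚ) ∈ v.asIdeal), (fontainePstAdicCompletion v p hv).IsCrystallineFramed (ψ.toLocal v) ∧ (letI := (fontainePstAdicCompletion v p hv).algebra; (∀ τ : v.adicCompletion ℚ →ₐ[ℚ_[p]] PadicAlgCl p, (let M := ψ.labelledHodgeTateWeightsAt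 v (fontainePstAdicCompletion v p hv).algebra (fontainePstAdicCompletion v p hv).𝔅 τ.toRingHom; M.Nodup ∧ Multiset.card M = 4)) ∧ Nonempty (PstCrystallineExtensionData (fontainePstAdicCompletion v p hv)) ∧ ∀ 𝔈 : PstCrystallineExtensionData (fontainePstAdicCompletion v p hv), IsPotentiallyDiagonalizable 𝔈.𝔅 (ψ.toLocal v))) → FramedGaloisRep.IsResiduallyAbsIrreducible (ψ.restrictField (CyclotomicField p ℚ)) → ∀ (φ : ℚ →+* ℝ) (c : absoluteGaloisGroup ℚ), IsComplexConjugation φ c → (ψ c).val.trace = 0 :=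
  Summit.Langlands.Langlands.Theorems.TensorSquareParallel.stub_traceComplexConjugation  -- LANDED p169312

/-- **stub 6 — the NEARLY ORDINARY dihedral corner is void, as a COMPOSITION (reshaped 2026-08-17 after the wave-1 verdict `stub-misstated`: the SPLIT hypothesis `∃ v ≠ w over p` is added — without it a non-split crystalline extension over a quadratic `F_v` is near-ordinary of no dominant weight and Qian's (ii) fails — and the external inputs are ANTECEDENTS: Qian 2023 Thm 1.4 at the pinned data for some local Artin data 𝓐, the local lemma near-ordinary ⇒ Qian-ordinary for the same 𝓐, AHTW 2026 Thm 1.2.1, labelwise HT base change; the elementary label-extension plumbing — a label of `F_v` and an embedding of a finite `E/F` extending it determine a place `w ∣ v` of `E` and a label of `E_w` extending both — is proved INSIDE this stub's file as a helper):** then `ρ` a.e. unramified, de Rham with labelled weights `{a<b}`, crystalline, with an invariant line at every `v ∣ p` and Qian's residual package is automorphic over a CM `K'` Galois over `F`, and Clozel purity (PROVED in tree, `CuspidalAutomorphicRepData.purity`) with the exact HT weights forces equal gaps at the two places over `p` — contradicting `hNP`.  Provable now (wave-1 scratch `ordinaryDihedralVoid_of_facts`, kernel-checked).  [cite: Qian2022,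 Thm. 1.4] [cite: Clozel1990, Lemme 4.9] -/
theorem stub_ordinaryDihedralVoid :
    ∀ 𝓐 : (∀ (K : Type) [Field K] [NumberField K] (v : HeightOneSpectrum (𝓞 K)), LocalArtinData (v.adicCompletion K)), Qian2022.potentialAutomorphy_ordinary 𝓐 (fun (K : Type) (_ : Field K) (_ : NumberField K) (p : ℕ) (_ : Fact p.Prime) (v : HeightOneSpectrum (𝓞 K)) (hv : ((p : ℕ) : 𝓞 K) ∈ v.asIdeal) => fontainePstAdicCompletion v p hv) → (∀ (F : Type) [Field F] [NumberField F] [Algebra.IsQuadraticExtension ℚ F] (p : ℕ) [Fact p.Prime] (ρ : FramedGaloisRep F (PadicAlgCl p) 2), (∃ v w : HeightOneSpectrum (𝓞 F), v ≠ w ∧ ((p : ℕ) : 𝓞 F) ∈ v.asIdeal ∧ ((p : ℕ) : 𝓞 F) ∈ w.asIdeal) → ∀ (v : HeightOneSpectrum (𝓞 F)) (hv : ((p : ℕ) : 𝓞 F) ∈ v.asIdeal), (fontainePstAdicCompletion v p hv).IsCrystallineFramed (ρ.toLocal v) → (letI := (fontainePstAdicCompletion v p hv).algebra; ∀ τ :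 v.adicCompletion F →ₐ[ℚ_[p]] PadicAlgCl p, ∃ a b : ℤ, a < b ∧ ρ.labelledHodgeTateWeightsAt v (fontainePstAdicCompletion v p hv).algebra (fontainePstAdicCompletion v p hv).𝔅 τ.toRingHom = {a, b}) → FramedRep.HasInvariantCompleteFlag (ρ.toLocal v) → ρ.IsOrdinaryRegularAt v (𝓐 F v)) → AHTW2026.hodgeTateWeights_eq (fun (K : Type) (_ : Field K) (_ : NumberField K) (p : ℕ) (_ : Fact p.Prime) (v : HeightOneSpectrum (𝓞 K)) (hv : ((p : ℕ) : 𝓞 K) ∈ v.asIdeal) => fontainePstAdicCompletion v p hv) → LabelledHodgeTateWeightsBaseChangeLabelwise → ∀ (F : Type) [Field F] [NumberField F] [Algebra.IsQuadraticExtension ℚ F], NumberField.IsTotallyComplex F → ∀ (p : ℕ) [Fact p.Prime] (ρ : FramedGaloisRep F (PadicAlgCl p) 2), (∃ v w : HeightOneSpectrum (𝓞 F), v ≠ w ∧ ((p : ℕ) : 𝓞 F) ∈ v.asIdeal ∧ ((p : ℕ) : 𝓞 F) ∈ w.asIdeal) → (∀ᶠ v : HeightOneSpectrum (𝓞 F)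 in Filter.cofinite, ρ.IsUnramifiedAt v) → (∀ (v : HeightOneSpectrum (𝓞 F)) (hv : ((p : ℕ) : 𝓞 F) ∈ v.asIdeal), (fontainePstAdicCompletion v p hv).IsDeRhamFramed (ρ.toLocal v) ∧ (letI := (fontainePstAdicCompletion v p hv).algebra; ∀ τ : v.adicCompletion F →ₐ[ℚ_[p]] PadicAlgCl p, ∃ a b : ℤ, a < b ∧ ρ.labelledHodgeTateWeightsAt v (fontainePstAdicCompletion v p hv).algebra (fontainePstAdicCompletion v p hv).𝔅 τ.toRingHom = {a, b})) → (∀ (v : HeightOneSpectrum (𝓞 F)) (hv : ((p : ℕ) : 𝓞 F) ∈ v.asIdeal), (fontainePstAdicCompletion v p hv).IsCrystallineFramed (ρ.toLocal v)) → (∀ v : HeightOneSpectrum (𝓞 F), ((p : ℕ) : 𝓞 F) ∈ v.asIdeal → FramedRep.HasInvariantCompleteFlag (ρ.toLocal v)) → (ρ.IsResidualRepOf (RingHom.id _) ρ.residualRep ∧ IsAbsIrreducible ρ.residualRep ∧ IsDecomposedGeneric ρ.residualRep ∧ IsAbsIrreducible (ρ.residualRep.comp (absGaloisGroupAdjoinRootsOfUnity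 F p).subtype) ∧ Subgroup.IsEnormous ((absGaloisGroupAdjoinRootsOfUnity F p).map ρ.residualRep) ∧ ∃ σ : absoluteGaloisGroup F, σ ∉ absGaloisGroupAdjoinRootsOfUnity F p ∧ ∃ c : padicAlgClResidueField p, ((ρ.residualRep σ : GL (Fin 2) (padicAlgClResidueField p)) : Matrix (Fin 2) (Fin 2) (padicAlgClResidueField p)) = c • (1 : Matrix (Fin 2) (Fin 2) (padicAlgClResidueField p))) → (∃ (v : HeightOneSpectrum (𝓞 F)) (hv : ((p : ℕ) : 𝓞 F) ∈ v.asIdeal) (w : HeightOneSpectrum (𝓞 F)) (hw : ((p : ℕ) : 𝓞 F) ∈ w.asIdeal), letI := (fontainePstAdicCompletion v p hv).algebra; letI := (fontainePstAdicCompletion w p hw).algebra; ∃ (τ : v.adicCompletion F →ₐ[ℚ_[p]] PadicAlgCl p) (σ : w.adicCompletion F →ₐ[ℚ_[p]] PadicAlgCl p) (a b a' b' : ℤ), ρ.labelledHodgeTateWeightsAt v (fontainePstAdicCompletion v p hv).algebra (fontainePstAdicCompletion v p hv).𝔅 τ.toRingHom = {a, b} ∧ a < b ∧ ρ.labelledHodgeTateWeightsAt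 w (fontainePstAdicCompletion w p hw).algebra (fontainePstAdicCompletion w p hw).𝔅 σ.toRingHom = {a', b'} ∧ a' < b' ∧ b - a ≠ b' - a') → False :=
  Summit.Langlands.Langlands.Theorems.TensorSquareParallel.stub_ordinaryDihedralVoid  -- LANDED p169582

/-- **stub 7a — the crux is VOID for `ρ` unramified away from `p` (all sectors; reshape v3 by the lead c1, 2026-08-17, = crux idea `odd-central-character-ramification`, first lemma `ParitySketch.stub_oddGapSum_ramified_away_from_p` verbatim).**  Odd gap sum `(b-a)+(b'-a')` ⟹ odd weight sum `(a+b)+(a'+b')` of `det ρ` at the two places over the SPLIT `p`; pinned crystallinity gives `det ρ|_{I_v} = ε^{-(a+b)}`, `det ρ|_{I_w} = ε^{-(a'+b')}` (clause (F12) of the pinned datum, `FontaineDatumExists.pinnedCrystallineDetOnInertia`, degree-one base); if `ρ` were unramified at every finite place not above `p`, global reciprocity for the continuous character `det ρ` evaluated at the principal idèle of the unit `-1 ∈ 𝓞_F^×` (no real place: `F` is totally complex; `χ_𝔮(-1) = 1` at unramified `𝔮 ∤ p`; `ε(rec(-1)) = -1` at `v`, `w`) gives `(-1)^{(a+b)+(a'+b')}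 = 1`, contradiction.  Hence `ρ` ramifies at some `𝔮 ∤ p`.  Size M (pinned det on inertia + the tree's global reciprocity for `ℓ`-adic characters).  Stated UNDER the T0 named fact `FontaineDatumExists` (clause (F12) is predicated of THE datum only under it, cf. `Theorems/NonParallelVoidEmptyWeightCorePinnedCrystallineDetLocalOfFDE`), which stub 3 supplies.  [cite: Calegari2010, §2 (context)] [folklore] -/
theorem stub_unramifiedOutsidePVoid :
    FontaineDatumExists → ∀ (F : Type) [Field F] [NumberField F] [Algebra.IsQuadraticExtension ℚ F], NumberField.IsTotallyComplex F → ∀ (p : ℕ) [Fact p.Prime] (ρ : FramedGaloisRep F (PadicAlgCl p) 2), (∀ (v : HeightOneSpectrum (𝓞 F)) (hv : ((p : ℕ) : 𝓞 F) ∈ v.asIdeal), (fontainePstAdicCompletion v p hv).IsDeRhamFramed (ρ.toLocal v) ∧ (letI := (fontainePstAdicCompletion v p hv).algebra; ∀ τ : v.adicCompletion F →ₐ[ℚ_[p]] PadicAlgCl p, ∃ a b : ℤ, a < b ∧ ρ.labelledHodgeTateWeightsAt v (fontainePstAdicCompletion v p hv).algebra (fontainePstAdicCompletion v p hv).𝔅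 τ.toRingHom = {a, b})) → (11 ≤ p ∧ (∃ v w : HeightOneSpectrum (𝓞 F), v ≠ w ∧ ((p : ℕ) : 𝓞 F) ∈ v.asIdeal ∧ ((p : ℕ) : 𝓞 F) ∈ w.asIdeal) ∧ (∀ (v : HeightOneSpectrum (𝓞 F)) (hv : ((p : ℕ) : 𝓞 F) ∈ v.asIdeal), (fontainePstAdicCompletion v p hv).IsCrystallineFramed (ρ.toLocal v)) ∧ FramedGaloisRep.IsResiduallyAbsIrreducible (ρ.restrictField (CyclotomicField p F))) → ¬ (∀ (v : HeightOneSpectrum (𝓞 F)) (hv : ((p : ℕ) : 𝓞 F) ∈ v.asIdeal) (w : HeightOneSpectrum (𝓞 F)) (hw : ((p : ℕ) : 𝓞 F) ∈ w.asIdeal), letI := (fontainePstAdicCompletion v p hv).algebra; letI := (fontainePstAdicCompletion w p hw).algebra; ∀ (τ : v.adicCompletion F →ₐ[ℚ_[p]] PadicAlgCl p) (σ : w.adicCompletion F →ₐ[ℚ_[p]] PadicAlgCl p) (a b a' b' : ℤ), ρ.labelledHodgeTateWeightsAt v (fontainePstAdicCompletion v p hv).algebra (fontainePstAdicCompletion v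 p hv).𝔅 τ.toRingHom = {a, b} → a < b → ρ.labelledHodgeTateWeightsAt w (fontainePstAdicCompletion w p hw).algebra (fontainePstAdicCompletion w p hw).𝔅 σ.toRingHom = {a', b'} → a' < b' → Even (b - a + (b' - a'))) → ¬ (∀ v : HeightOneSpectrum (𝓞 F), ((p : ℕ) : 𝓞 F) ∉ v.asIdeal → ρ.IsUnramifiedAt v) := by
  sorry

/-- **stub 7b — the supersingular dihedral corner, RAMIFIED somewhere away from `p` (honest OPEN remainder; reshape v3: = v2 stub 7 `stub_supersingularDihedral` with the extra hypothesis "`ρ` is NOT unramified at every finite place prime to `p`", the complementary case being stub 7a).**  Sector S of the strategist split: `ρ̄|Γ_{F(ζ_p)}` projectively dihedral (trace predicate) and no invariant line at some `v ∣ p`.  No engine in print (Taylor–Wiles/BLGGT: `ψ̄` reducible; Qian / ACC+ 6.1.2 / Calegari–Mazur §2.4: not ordinary; ACC+ 6.1.1: needs residual automorphy in the non-parallel weight; no change of weight at defect one; Calegari 2012 (FM II) avoids PD only over `ℚ` via shadow tensoring).  Candidate mechanisms: torsion-fed Fontaine–Laffaille emptiness (sibling crux `EmptyWeightCore`); overconvergent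 classicality.  Size: open (crux-sized).
[cite: CalegariMazur2008, Conj. 1.3] [cite: CalegariGeraghty2017, §1] [cite: ACCGHLNSTT2023, Thm. 6.1.1] -/
theorem stub_supersingularDihedralRamified :
    ∀ (F : Type) [Field F] [NumberField F] [Algebra.IsQuadraticExtension ℚ F], NumberField.IsTotallyComplex F → ∀ (p : ℕ) [Fact p.Prime] (ρ : FramedGaloisRep F (PadicAlgCl p) 2), ρ.toGaloisRep.IsIrreducible → (∀ᶠ v : HeightOneSpectrum (𝓞 F) in Filter.cofinite, ρ.IsUnramifiedAt v) → (∀ (v : HeightOneSpectrum (𝓞 F)) (hv : ((p : ℕ) : 𝓞 F) ∈ v.asIdeal), (fontainePstAdicCompletion v p hv).IsDeRhamFramed (ρ.toLocal v) ∧ (letI := (fontainePstAdicCompletion v p hv).algebra; ∀ τ : v.adicCompletion F →ₐ[ℚ_[p]] PadicAlgCl p, ∃ a b : ℤ, a < b ∧ ρ.labelledHodgeTateWeightsAt v (fontainePstAdicCompletion v p hv).algebra (fontainePstAdicCompletion v p hv).𝔅 τ.toRingHom = {a, b})) → (11 ≤ p ∧ (∃ v w : HeightOneSpectrum (𝓞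 F), v ≠ w ∧ ((p : ℕ) : 𝓞 F) ∈ v.asIdeal ∧ ((p : ℕ) : 𝓞 F) ∈ w.asIdeal) ∧ (∀ (v : HeightOneSpectrum (𝓞 F)) (hv : ((p : ℕ) : 𝓞 F) ∈ v.asIdeal), (fontainePstAdicCompletion v p hv).IsCrystallineFramed (ρ.toLocal v)) ∧ FramedGaloisRep.IsResiduallyAbsIrreducible (ρ.restrictField (CyclotomicField p F))) → ¬ (∀ (v : HeightOneSpectrum (𝓞 F)) (hv : ((p : ℕ) : 𝓞 F) ∈ v.asIdeal) (w : HeightOneSpectrum (𝓞 F)) (hw : ((p : ℕ) : 𝓞 F) ∈ w.asIdeal), letI := (fontainePstAdicCompletion v p hv).algebra; letI := (fontainePstAdicCompletion w p hw).algebra; ∀ (τ : v.adicCompletion F →ₐ[ℚ_[p]] PadicAlgCl p) (σ : w.adicCompletion F →ₐ[ℚ_[p]] PadicAlgCl p) (a b a' b' : ℤ), ρ.labelledHodgeTateWeightsAt v (fontainePstAdicCompletion v p hv).algebra (fontainePstAdicCompletion v p hv).𝔅 τ.toRingHom = {a, b} → a < b → ρ.labelledHodgeTateWeightsAt w (fontainePstAdicCompletion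 w p hw).algebra (fontainePstAdicCompletion w p hw).𝔅 σ.toRingHom = {a', b'} → a' < b' → Even (b - a + (b' - a'))) → ¬ (∃ τ : absoluteGaloisGroup ℚ, τ ∉ Set.range (absGaloisRestrict ℚ F) ∧ ∃ χ : absoluteGaloisGroup F →* (padicAlgClResidueField p)ˣ, ∀ σ σ' : absoluteGaloisGroup F, absGaloisRestrict ℚ F σ' = τ * absGaloisRestrict ℚ F σ * τ⁻¹ → (ρ.residualRep σ').val.trace = (χ σ : padicAlgClResidueField p) * (ρ.residualRep σ).val.trace ∧ (ρ.residualRep σ').val.det = (χ σ : padicAlgClResidueField p) ^ 2 * (ρ.residualRep σ).val.det) → (∃ η : absoluteGaloisGroup (CyclotomicField p F) →* (padicAlgClResidueField p)ˣ, η ≠ 1 ∧ ∀ σ : absoluteGaloisGroup (CyclotomicField p F), (ρ.residualRep (absGaloisRestrict F (CyclotomicField p F) σ)).val.trace = (η σ : padicAlgClResidueField p) * (ρ.residualRep (absGaloisRestrict F (CyclotomicField p F) σ)).val.trace) → ¬ (∀ v : HeightOneSpectrum (𝓞 F), ((p : ℕ) : 𝓞 F) ∈ v.asIdeal → FramedRep.HasInvariantCompleteFlag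 (ρ.toLocal v)) → ¬ (∀ v : HeightOneSpectrum (𝓞 F), ((p : ℕ) : 𝓞 F) ∉ v.asIdeal → ρ.IsUnramifiedAt v) → ∃ g : ℤ, ∀ (v : HeightOneSpectrum (𝓞 F)) (hv : ((p : ℕ) : 𝓞 F) ∈ v.asIdeal), letI := (fontainePstAdicCompletion v p hv).algebra; ∀ τ : v.adicCompletion F →ₐ[ℚ_[p]] PadicAlgCl p, ∃ a : ℤ, ρ.labelledHodgeTateWeightsAt v (fontainePstAdicCompletion v p hv).algebra (fontainePstAdicCompletion v p hv).𝔅 τ.toRingHom = {a, a + g} := by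
  sorry

/-! ## Landed stubs (wave 1) — theorems of this file by import, no sorry -/

/-- **landed stub — residual irreducibility of the tensor induction on `Γ_{ℚ(ζ_p)}`** (p168846, classification-free Clifford/determinant-pairing proof). [cite: Calegari2010, §6] -/
theorem stub_residualIrreducibility :
    ∀ (F : Type) [Field F] [NumberField F] [Algebra.IsQuadraticExtension ℚ F], NumberField.IsTotallyComplex F → ∀ (p : ℕ) [Fact p.Prime] (ρ : FramedGaloisRep F (PadicAlgCl p) 2), ρ.toGaloisRep.IsIrreducible → (∀ᶠ v : HeightOneSpectrum (𝓞 F) in Filter.cofinite, ρ.IsUnramifiedAt v) → (∀ (v : HeightOneSpectrum (𝓞 F)) (hv : ((p : ℕ) : 𝓞 F) ∈ v.asIdeal), (fontainePstAdicCompletion v p hv).IsDeRhamFramed (ρ.toLocal v) ∧ (letI := (fontainePstAdicCompletion v p hv).algebra; ∀ τ : v.adicCompletion F →ₐ[ℚ_[p]] PadicAlgCl p, ∃ a b : ℤ, a < b ∧ ρ.labelledHodgeTateWeightsAt v (fontainePstAdicCompletion v p hv).algebra (fontainePstAdicCompletion v p hv).𝔅 τ.toRingHom = {a, b})) → (11 ≤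 p ∧ (∃ v w : HeightOneSpectrum (𝓞 F), v ≠ w ∧ ((p : ℕ) : 𝓞 F) ∈ v.asIdeal ∧ ((p : ℕ) : 𝓞 F) ∈ w.asIdeal) ∧ (∀ (v : HeightOneSpectrum (𝓞 F)) (hv : ((p : ℕ) : 𝓞 F) ∈ v.asIdeal), (fontainePstAdicCompletion v p hv).IsCrystallineFramed (ρ.toLocal v)) ∧ FramedGaloisRep.IsResiduallyAbsIrreducible (ρ.restrictField (CyclotomicField p F))) → ¬ (∃ τ : absoluteGaloisGroup ℚ, τ ∉ Set.range (absGaloisRestrict ℚ F) ∧ ∃ χ : absoluteGaloisGroup F →* (padicAlgClResidueField p)ˣ, ∀ σ σ' : absoluteGaloisGroup F, absGaloisRestrict ℚ F σ' = τ * absGaloisRestrict ℚ F σ * τ⁻¹ → (ρ.residualRep σ').val.trace = (χ σ : padicAlgClResidueField p) * (ρ.residualRep σ).val.trace ∧ (ρ.residualRep σ').val.det = (χ σ : padicAlgClResidueField p) ^ 2 * (ρ.residualRep σ).val.det) → ¬ (∃ η : absoluteGaloisGroup (CyclotomicField p F) →* (padicAlgClResidueField p)ˣ, η ≠ 1 ∧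 ∀ σ : absoluteGaloisGroup (CyclotomicField p F), (ρ.residualRep (absGaloisRestrict F (CyclotomicField p F) σ)).val.trace = (η σ : padicAlgClResidueField p) * (ρ.residualRep (absGaloisRestrict F (CyclotomicField p F) σ)).val.trace) → ∀ ψ : FramedGaloisRep ℚ (PadicAlgCl p) 4, (∀ τ : absoluteGaloisGroup ℚ, τ ∉ Set.range (absGaloisRestrict ℚ F) → ∀ σ σ' : absoluteGaloisGroup F, absGaloisRestrict ℚ F σ' = τ * absGaloisRestrict ℚ F σ * τ⁻¹ → (ψ (absGaloisRestrict ℚ F σ)).val.trace = (ρ σ).val.trace * (ρ σ').val.trace) → FramedGaloisRep.IsResiduallyAbsIrreducible (ψ.restrictField (CyclotomicField p ℚ)) :=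
  Summit.Langlands.Langlands.Theorems.TensorSquareParallel.stub_residualIrreducibility

/-- **landed stub — the trace predicate means projectively dihedral** (p167854). [cite: ACCGHLNSTT2023, Def. 6.2.28 (context)] -/
theorem stub_dihedralType_of_trace :
    ∀ (F : Type) [Field F] [NumberField F] [Algebra.IsQuadraticExtension ℚ F], NumberField.IsTotallyComplex F → ∀ (p : ℕ) [Fact p.Prime] (ρ : FramedGaloisRep F (PadicAlgCl p) 2), 11 ≤ p → FramedGaloisRep.IsResiduallyAbsIrreducible (ρ.restrictField (CyclotomicField p F)) → (∃ η : absoluteGaloisGroup (CyclotomicField p F) →* (padicAlgClResidueField p)ˣ, η ≠ 1 ∧ ∀ σ : absoluteGaloisGroup (CyclotomicField p F), (ρ.residualRep (absGaloisRestrict F (CyclotomicField p F) σ)).val.trace = (η σ : padicAlgClResidueField p) * (ρ.residualRep (absGaloisRestrict F (CyclotomicField p F) σ)).val.trace) → IsDihedralType (ρ.residualRep.comp (absGaloisGroupAdjoinRootsOfUnity F p).subtype) ∧ Finite (ρ.residualRep.comp (absGaloisGroupAdjoinRootsOfUnity F p).subtype).range ∧ ¬ p ∣ Nat.card (ρ.residualRep.comp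 (absGaloisGroupAdjoinRootsOfUnity F p).subtype).range :=
  Summit.Langlands.Langlands.Theorems.TensorSquareParallel.stub_dihedralType_of_trace

/-- **landed stub — dihedral images are enormous; Qian's residual package** (p168313; helpers p167375, p168142, p167929). [cite: ACCGHLNSTT2023, Def. 6.2.28] [cite: CaraianiNewton2023, Lemma 6.2.2] -/
theorem stub_enormousResidualPackage :
    ∀ (F : Type) [Field F] [NumberField F] [Algebra.IsQuadraticExtension ℚ F], NumberField.IsTotallyComplex F → ∀ (p : ℕ) [Fact p.Prime] (ρ : FramedGaloisRep F (PadicAlgCl p) 2), 11 ≤ p → (∃ v w : HeightOneSpectrum (𝓞 F), v ≠ w ∧ ((p : ℕ) : 𝓞 F) ∈ v.asIdeal ∧ ((p : ℕ) : 𝓞 F) ∈ w.asIdeal) → FramedGaloisRep.IsResiduallyAbsIrreducible (ρ.restrictField (CyclotomicField p F)) → IsDihedralType (ρ.residualRep.comp (absGaloisGroupAdjoinRootsOfUnity F p).subtype) → Finite (ρ.residualRep.comp (absGaloisGroupAdjoinRootsOfUnity F p).subtype).range → ¬ p ∣ Nat.card (ρ.residualRep.comp (absGaloisGroupAdjoinRootsOfUnity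 F p).subtype).range → (ρ.IsResidualRepOf (RingHom.id _) ρ.residualRep ∧ IsAbsIrreducible ρ.residualRep ∧ IsDecomposedGeneric ρ.residualRep ∧ IsAbsIrreducible (ρ.residualRep.comp (absGaloisGroupAdjoinRootsOfUnity F p).subtype) ∧ Subgroup.IsEnormous ((absGaloisGroupAdjoinRootsOfUnity F p).map ρ.residualRep) ∧ ∃ σ : absoluteGaloisGroup F, σ ∉ absGaloisGroupAdjoinRootsOfUnity F p ∧ ∃ c : padicAlgClResidueField p, ((ρ.residualRep σ : GL (Fin 2) (padicAlgClResidueField p)) : Matrix (Fin 2) (Fin 2) (padicAlgClResidueField p)) = c • (1 : Matrix (Fin 2) (Fin 2) (padicAlgClResidueField p))) :=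
  Summit.Langlands.Langlands.Theorems.TensorSquareParallel.stub_enormousResidualPackage

/-! ## The stub statements as named `Prop`s (literally their types) — the registrar's by-name hypotheses -/

namespace _Goal

/-- The statement of `stub_tensorInductionLocal`, as a named `Prop` (literally its type; no `sorry` in it). -/
def stub_tensorInductionLocal : Prop :=
  type_of% @Summit.Langlands.Langlands.Cruxes.TensorSquareParallel.Merged.stub_tensorInductionLocal

/-- The statement of `stub_externalInputs`, as a named `Prop` (literally its type; no `sorry` in it). -/
def stub_externalInputs : Prop :=
  type_of% @Summit.Langlands.Langlands.Cruxes.TensorSquareParallel.Merged.stub_externalInputs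

/-- The statement of `stub_unramifiedOutsidePVoid`, as a named `Prop` (literally its type; no `sorry` in it). -/
def stub_unramifiedOutsidePVoid : Prop :=
  type_of% @Summit.Langlands.Langlands.Cruxes.TensorSquareParallel.Merged.stub_unramifiedOutsidePVoid

/-- The statement of `stub_supersingularDihedralRamified`, as a named `Prop` (literally its type; no `sorry` in it). -/
def stub_supersingularDihedralRamified : Prop :=
  type_of% @Summit.Langlands.Langlands.Cruxes.TensorSquareParallel.Merged.stub_supersingularDihedralRamified

end _Goal

/-- Read-back: the four OPEN stubs prove their named statements (definitionally their own types); the six landed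
stubs are theorems of this file. -/
theorem goals_hold :
    _Goal.stub_tensorInductionLocal ∧ _Goal.stub_externalInputs ∧ _Goal.stub_unramifiedOutsidePVoid ∧
      _Goal.stub_supersingularDihedralRamified :=
  ⟨stub_tensorInductionLocal, stub_externalInputs, stub_unramifiedOutsidePVoid, stub_supersingularDihedralRamified⟩

/-- **`TensorSquareParallel` from the four OPEN stubs (v3; the six landed stubs are used as theorems; v3 adds the top-level case "unramified away from `p`" closed by stub 7a)** — kernel-checked
composition (no sorry).  Case split on the
projectively dihedral predicate over `F(ζ_p)`.  OFF it: the odd-gap clause yields two labels with different gaps,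
stub 1 the tensor induction `ψ` with (T0), (T0'), (T1), (T2), (T5); stub 2 its local clause (T3) from (T0'); the LANDED
residual-irreducibility stub its irreducibility on `Γ_{ℚ(ζ_p)}` from (T0); stub 4 (fed with [BLGGT] Thm C and CLH from
stub 3) `tr ψ(c) = 0` at a complex conjugation `c ∈ Γ_ℚ` — against (T5).  ON it: supersingular somewhere: stub 7 (open
remainder); an invariant line everywhere: the LANDED dihedral-type and enormous-package stubs, then stub 6 fed with
Qian / the local lemma / AHTW / HT base change (stub 3), and the split clause of `hG`.
[cite: Calegari2010, §2] [cite: BarnetlambEtAl2014, Thm. C] [cite: Qian2022, Thm. 1.4] [cite: Clozel1990, Lemme 4.9] -/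
theorem TensorSquareParallel_of
    (h₂ : _Goal.stub_tensorInductionLocal) (h₃ : _Goal.stub_externalInputs)
    (h₇a : _Goal.stub_unramifiedOutsidePVoid) (h₇ : _Goal.stub_supersingularDihedralRamified) :
    Summit.Langlands.Langlands.Theses.NonParallelVoid.TensorSquareParallel := by
  have HTI : type_of% @stub_tensorInductionExists := stub_tensorInductionExists  -- landed p169281
  have HTL : type_of% @stub_tensorInductionLocal := h₂
  have HEX : type_of% @stub_externalInputs := h₃
  have HTZ : type_of% @stub_traceComplexConjugation := stub_traceComplexConjugation  -- landed p169312
  have HOV : type_of% @stub_ordinaryDihedralVoid := stub_ordinaryDihedralVoid  -- landed p169582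
  have HUV : type_of% @stub_unramifiedOutsidePVoid := h₇a
  have HSS : type_of% @stub_supersingularDihedralRamified := h₇
  clear h₂ h₃ h₇a h₇
  obtain ⟨hFD, hC, hCLH, hAHTW, hBC, 𝓐, hQ, hOrd⟩ := HEX
  intro F _ _ _ hF p _ ρ hirr hunr hHT hG hE hB
  -- the locus "unramified at every finite place prime to `p`" is void outright (stub 7a, parity of `det ρ` at `-1`)
  by_cases hU : (∀ v : HeightOneSpectrum (𝓞 F), ((p : ℕ) : 𝓞 F) ∉ v.asIdeal → ρ.IsUnramifiedAt v)
  · exact absurd hU (HUV hFD F hF p ρ hHT hG hE)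
  -- two labels with different gaps, from the failure of the parity clause (used on both attacked branches)
  have hNP : (∃ (v : HeightOneSpectrum (𝓞 F)) (hv : ((p : ℕ) : 𝓞 F) ∈ v.asIdeal) (w : HeightOneSpectrum (𝓞 F)) (hw : ((p : ℕ) : 𝓞 F) ∈ w.asIdeal), letI := (fontainePstAdicCompletion v p hv).algebra; letI := (fontainePstAdicCompletion w p hw).algebra; ∃ (τ : v.adicCompletion F →ₐ[ℚ_[p]] PadicAlgCl p) (σ : w.adicCompletion F →ₐ[ℚ_[p]] PadicAlgCl p) (a b a' b' : ℤ), ρ.labelledHodgeTateWeightsAt v (fontainePstAdicCompletion v p hv).algebra (fontainePstAdicCompletion v p hv).𝔅 τ.toRingHom = {a, b} ∧ a < b ∧ ρ.labelledHodgeTateWeightsAt w (fontainePstAdicCompletion w p hw).algebra (fontainePstAdicCompletion w p hw).𝔅 σ.toRingHom = {a', b'} ∧ a' < b' ∧ b - a ≠ b' - a') := by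
    by_contra hcon
    apply hE
    intro v hv w hw τ σ a b a' b' h1 h2 h3 h4
    by_contra hodd
    exact hcon ⟨v, hv, w, hw, τ, σ, a, b, a', b', h1, h2, h3, h4, fun heq => hodd ⟨b - a, by rw [← heq]⟩⟩
  by_cases hD : (∃ η : absoluteGaloisGroup (CyclotomicField p F) →* (padicAlgClResidueField p)ˣ, η ≠ 1 ∧ ∀ σ : absoluteGaloisGroup (CyclotomicField p F), (ρ.residualRep (absGaloisRestrict F (CyclotomicField p F) σ)).val.trace = (η σ : padicAlgClResidueField p) * (ρ.residualRep (absGaloisRestrict F (CyclotomicField p F) σ)).val.trace)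
  · by_cases hLR : (∀ v : HeightOneSpectrum (𝓞 F), ((p : ℕ) : 𝓞 F) ∈ v.asIdeal → FramedRep.HasInvariantCompleteFlag (ρ.toLocal v))
    · -- the nearly ordinary dihedral corner: dihedral type ⟹ enormous ⟹ Qian ⟹ purity
      exfalso
      obtain ⟨hdt, hfin, hcop⟩ := stub_dihedralType_of_trace F hF p ρ hG.1 hG.2.2.2 hD
      have hRP := stub_enormousResidualPackage F hF p ρ hG.1 hG.2.1 hG.2.2.2 hdt hfin hcop
      exact HOV 𝓐 hQ hOrd hAHTW hBC F hF p ρ hG.2.1 hunr hHT hG.2.2.1 hLR hRP hNP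
    · exact HSS F hF p ρ hirr hunr hHT hG hE hB hD hLR hU
  · -- off the corner: the tensor induction line
    exfalso
    obtain ⟨ψ, hT0, hT0', hT1, hT2, hT5⟩ := HTI F hF p ρ hunr
    have hT3 := HTL F hF p ρ hHT hG hNP ψ hT0'
    have hT4 := stub_residualIrreducibility F hF p ρ hirr hunr hHT hG hB hD ψ hT0
    obtain ⟨c, hc⟩ := exists_isComplexConjugation (Rat.castHom ℝ)
    exact hT5 _ c hc (HTZ hC hCLH p hG.1 ψ hT1 hT2 hT3 hT4 _ c hc)

/-- By-name sanity check (an `example`, not a declaration): `TensorSquareParallel` modulo exactly the four open stubs. -/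
example : Summit.Langlands.Langlands.Theses.NonParallelVoid.TensorSquareParallel :=
  TensorSquareParallel_of stub_tensorInductionLocal stub_externalInputs stub_unramifiedOutsidePVoid
    stub_supersingularDihedralRamified

end Summit.Langlands.Langlands.Cruxes.TensorSquareParallel.Merged

end
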